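import Literature.Geometry.Kaehler.ComplexTorusIrreduciblePrincipallyPolarized
import HarnessLib

/-!
# Clemens–Griffiths (3.17)–(3.18): sums of principally polarized complex tori, and positivity pulls back along
# morphisms — the source of a morphism into a principally polarized abelian variety is a principally polarized
# abelian variety

Layer `Literature/Geometry/Kaehler`, namespace `Literature.Geometry.Kaehler.ComplexTorus`; lane `lit-hodgefound`
(Track 2 foundations library; prover seat `lit-hodgefound-p26`, gen 13, row g13-#2 FILE 2 — the theorems-only sibling of
`ComplexTorusIrreduciblePrincipallyPolarized.lean`, which holds the definition `IsPolarizedIrreducible` = C–G Def. 3.22).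
THEOREMS ONLY; no definition, no named fact.

## Source, verbatim

C. H. Clemens, P. A. Griffiths, *The intermediate Jacobian of the cubic threefold*, Ann. of Math. 95 (1972), §3, p. 296
(held `paper:doi-10-2307-1970801` p0017): "Next we let `𝒞` denote the set of isomorphism classes of principally
polarized complex tori. We define an equivalence relation (~) in `𝒞` as follows: (3.16) `𝒯 ~ 𝒯'` if there exist
non-singular (possibly reducible) curves `C` and `C'` such that there are morphisms `𝒯 → 𝒯' ⊕ 𝒥(C')`,
`𝒯' → 𝒯 ⊕ 𝒥(C)`. This equivalence relation has the properties: (3.17) If `𝒯₁ ~ 𝒯₁'` and `𝒯₂ ~ 𝒯₂'` then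
`(𝒯₁ ⊕ 𝒯₂) ~ (𝒯₁' ⊕ 𝒯₂')`. (3.18) If `𝒯` is a principally polarized abelian variety and `𝒯 ~ 𝒯'`, then `𝒯'` is a
principally polarized abelian variety." — with p. 293: Def. 3.5 (principally polarized complex torus: `ℋ` non-degenerate,
`Im ℋ` integral and unimodular on `U`; morphisms `α` with `α(U₁) ⊂ U₂`, `ℋ₁ = (ℋ₂)_α`; "This implies that `α : W₁ → W₂`
is injective"), (3.7)–(3.8) (`𝒥(V)`, `𝒥(C)` are principally polarized abelian varieties when `ℋ` is positive definite).

## What is proved (the MECHANISM of (3.17)–(3.18); the relation `~` itself quantifies over Jacobians of curves and is not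
formalised here)

On the tree's carriers (as in the sibling file: `𝒯 = (X = E/Φ(ℤ^ι), η)`, `|deg (X, η)| = |polarizationDegree Φ η| = 1`;
a morphism `φ : 𝒯' → 𝒯` is `ρ(M)` with `ℂ`-linear analytic representation `F`, `Φ ∘ M_ℝ = F ∘ Φ₁`, the source carrying
`F^*η` with `|deg (X₁, F^*η)| = 1`; `𝒯₁ ⊕ 𝒯₂ = (X₁ × X₂, ω₁ ⊞ ω₂)` is `prodPeriod` / `prodForm`):

* §1 **(3.17), the object part: `𝒯₁ ⊕ 𝒯₂` is a principally polarized complex torus** —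
  `abs_polarizationDegree_prod` (`|deg (X₁ × X₂, ω₁ ⊞ ω₂)| = |deg X₁| · |deg X₂|`),
  `abs_polarizationDegree_prod_eq_one`; the positive case is the tree's `IsPrincipalPolarization.prod`.
* §2 **(3.18), the mechanism: positivity pulls back along morphisms** — `isRiemannForm_pullbackForm_of_abs_polarizationDegree`
  (a morphism of principally polarized complex tori into a torus whose form is a RIEMANN form has injective `α = F`
  (g12-#4 `analyticRep_injective_of_isUnimodular`), so `F^*η` is a Riemann form: the source is a polarized abelian
  variety), `IsPrincipalPolarization.pullbackForm_of_abs_polarizationDegree` (… a principally polarized abelian variety),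
  **`clemensGriffiths_3_18`** (the printed shape: a morphism `𝒯' → 𝒯 ⊕ 𝒥` with `𝒯`, `𝒥` principally polarized abelian
  varieties — `𝒥 = 𝒥(C)` in the text, a p.p.a.v. by (3.8) — makes `𝒯'` a principally polarized abelian variety), and
  `IsPrincipalPolarization.isEmpty_or_isPrincipalPolarization_and_exists_isPolarizedIso` (into an IRREDUCIBLE p.p.a.v.,
  Def. 3.22: the source is `0` or a p.p.a.v. isomorphic to the target via `φ`).

-- TODO(general form): the relation `~` of (3.16) and the semigroups `G`, `A` of (3.19), Cor. 3.24, once Jacobians of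
-- curves `𝒥(C)` (3.8) are available as principally polarized abelian varieties on these carriers.

## References

* [ClemensGriffiths1972] C. H. Clemens, P. A. Griffiths, The intermediate Jacobian of the cubic threefold, Ann. of
  Math. (2) 95 (1972) 281–356, §3 Def. 3.5, (3.7)–(3.8) (p. 293), (3.16)–(3.18) (p. 296), Def. 3.22 (p. 297).
* [Lange2023AbelianVarietiesComplex] H. Lange, Abelian Varieties over the Complex Numbers, Springer 2023, §2.1.1
  Cor. 2.1.4 (restriction of a polarization to an abelian subvariety), §2.4.4 Cor. 2.4.24 (products).
-/

noncomputable section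

open Module Function Complex Submodule
open scoped Matrix
open LinearMap (BilinForm)

namespace Literature.Geometry.Kaehler

namespace ComplexTorus

universe u

variable {ι : Type*} [Fintype ι] [DecidableEq ι] {E : Type u} [NormedAddCommGroup E] [NormedSpace ℂ E]
  (Φ : (ι → ℝ) ≃L[ℝ] E) {η : E [⋀^Fin 2]→L[ℝ] ℝ}

/-! ## §1 (3.17): the sum `𝒯₁ ⊕ 𝒯₂` of principally polarized complex tori is principally polarized -/

section Sum

variable {ι₂ : Type*} [Fintype ι₂] [DecidableEq ι₂] {E₂ : Type*} [NormedAddCommGroup E₂] [NormedSpace ℂ E₂]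
  (Φ₂ : (ι₂ → ℝ) ≃L[ℝ] E₂) (η₁ : E [⋀^Fin 2]→L[ℝ] ℝ) (η₂ : E₂ [⋀^Fin 2]→L[ℝ] ℝ)

/-- **`|deg (X₁ × X₂, ω₁ ⊞ ω₂)| = |deg (X₁, ω₁)| · |deg (X₂, ω₂)|`** (block-diagonal Gram matrix).
[cite: ClemensGriffiths1972, §3 (3.17), p. 296] [cite: Lange2023AbelianVarietiesComplex, §2.4.4 Cor. 2.4.24] -/
theorem abs_polarizationDegree_prod :
    |polarizationDegree (prodPeriod Φ Φ₂) (prodForm η₁ η₂)| = |polarizationDegree Φ η₁| * |polarizationDegree Φ₂ η₂| := by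
  rw [polarizationDegree_prod, abs_mul]

/-- **(3.17), objects: the sum of two principally polarized complex tori is a principally polarized complex torus**
(`|deg| = 1` is multiplicative; type `(1,1)` and integrality of `ω₁ ⊞ ω₂` are the tree's `prodForm` lemmas, and the
positive case is `IsPrincipalPolarization.prod`). [cite: ClemensGriffiths1972, §3 Def. 3.5 and (3.17), pp. 293, 296] -/
theorem abs_polarizationDegree_prod_eq_one (h₁ : |polarizationDegree Φ η₁| = 1) (h₂ : |polarizationDegree Φ₂ η₂| = 1) :
    |polarizationDegree (prodPeriod Φ Φ₂) (prodForm η₁ η₂)| = 1 := by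
  rw [abs_polarizationDegree_prod, h₁, h₂, mul_one]

end Sum

/-! ## §2 (3.18): positivity pulls back along morphisms of principally polarized complex tori -/

section PositivityTransfer

omit [Fintype ι] [DecidableEq ι] in
/-- **The mechanism of Clemens–Griffiths (3.18) — "If `𝒯` is a principally polarized abelian variety and `𝒯 ~ 𝒯'`,
then `𝒯'` is a principally polarized abelian variety."** For a morphism `φ = ρ(M) : 𝒯' = (X₁, F^*η) → (X, η)` of
principally polarized complex tori (`|deg (X₁, F^*η)| = 1`) whose target form `η` is a RIEMANN form (the target is a
polarized abelian variety): `α = F` is injective (g12-#4), so `F^*η` is again a Riemann form — the source is a polarized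
abelian variety. [cite: ClemensGriffiths1972, §3 (3.16)–(3.18), p. 296] [cite: Lange2023AbelianVarietiesComplex, §2.1.1 Cor. 2.1.4] -/
theorem isRiemannForm_pullbackForm_of_abs_polarizationDegree (hη : IsRiemannForm Φ η)
    {ι₁ : Type*} [Fintype ι₁] [DecidableEq ι₁] {E₁ : Type*} [NormedAddCommGroup E₁] [NormedSpace ℂ E₁]
    (Φ₁ : (ι₁ → ℝ) ≃L[ℝ] E₁) {M : Matrix ι ι₁ ℤ} {F : E₁ →L[ℂ] E}
    (hF : ∀ x, Φ ((M.map (Int.cast : ℤ → ℝ)) *ᵥ x) = F (Φ₁ x)) (hdeg : |polarizationDegree Φ₁ (pullbackForm F η)| = 1) :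
    IsRiemannForm Φ₁ (pullbackForm F η) := by
  obtain ⟨B, hB⟩ := exists_bilinForm_int_of_integral hη.2.1
  obtain ⟨B₁, hB₁⟩ := exists_bilinForm_int_of_integral (integral_pullbackForm_of_analyticRep Φ hB Φ₁ hF)
  have h₁ : B₁.IsUnimodular := (isUnimodular_iff_abs_polarizationDegree Φ₁ hB₁).2 hdeg
  exact hη.pullback Φ₁ Φ hF (analyticRep_injective_of_isUnimodular Φ₁ Φ hF hB hB₁ h₁)

/-- **(3.18), principal form: the source of a morphism of principally polarized complex tori into a principally
polarized abelian variety is a principally polarized abelian variety.**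
[cite: ClemensGriffiths1972, §3 (3.18), p. 296] [cite: Lange2023AbelianVarietiesComplex, §2.1.1 Cor. 2.1.4] -/
theorem IsPrincipalPolarization.pullbackForm_of_abs_polarizationDegree (hP : IsPrincipalPolarization Φ η)
    {ι₁ : Type*} [Fintype ι₁] [DecidableEq ι₁] {E₁ : Type*} [NormedAddCommGroup E₁] [NormedSpace ℂ E₁]
    (Φ₁ : (ι₁ → ℝ) ≃L[ℝ] E₁) {M : Matrix ι ι₁ ℤ} {F : E₁ →L[ℂ] E}
    (hF : ∀ x, Φ ((M.map (Int.cast : ℤ → ℝ)) *ᵥ x) = F (Φ₁ x)) (hdeg : |polarizationDegree Φ₁ (pullbackForm F η)| = 1) :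
    IsPrincipalPolarization Φ₁ (pullbackForm F η) := by
  have hR := isRiemannForm_pullbackForm_of_abs_polarizationDegree Φ hP.isRiemannForm Φ₁ hF hdeg
  obtain ⟨B₁, hB₁⟩ := exists_bilinForm_int_of_integral hR.2.1
  exact (hR.isUnimodular_iff_isPrincipalPolarization Φ₁ hB₁).1 ((isUnimodular_iff_abs_polarizationDegree Φ₁ hB₁).2 hdeg)

/-- **Clemens–Griffiths (3.18), as printed up to the provenance of `𝒥`**: if `𝒯 = (X, η)` and `𝒥 = (X₂, ω)` are
principally polarized ABELIAN VARIETIES (in the text `𝒥 = 𝒥(C)` is the Jacobian of a curve, a p.p.a.v. by (3.8)) and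
`φ : 𝒯' → 𝒯 ⊕ 𝒥` is a morphism of principally polarized complex tori, then `𝒯'` is a principally polarized abelian
variety. [cite: ClemensGriffiths1972, §3 (3.16)–(3.18) and (3.8), pp. 293, 296] -/
theorem clemensGriffiths_3_18 (hP : IsPrincipalPolarization Φ η)
    {ι₂ : Type*} [Fintype ι₂] [DecidableEq ι₂] {E₂ : Type*} [NormedAddCommGroup E₂] [NormedSpace ℂ E₂]
    {Φ₂ : (ι₂ → ℝ) ≃L[ℝ] E₂} {ω : E₂ [⋀^Fin 2]→L[ℝ] ℝ} (hJ : IsPrincipalPolarization Φ₂ ω)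
    {ι₁ : Type*} [Fintype ι₁] [DecidableEq ι₁] {E₁ : Type*} [NormedAddCommGroup E₁] [NormedSpace ℂ E₁]
    (Φ₁ : (ι₁ → ℝ) ≃L[ℝ] E₁) {M : Matrix (ι ⊕ ι₂) ι₁ ℤ} {F : E₁ →L[ℂ] E × E₂}
    (hF : ∀ x, prodPeriod Φ Φ₂ ((M.map (Int.cast : ℤ → ℝ)) *ᵥ x) = F (Φ₁ x))
    (hdeg : |polarizationDegree Φ₁ (pullbackForm F (prodForm η ω))| = 1) :
    IsPrincipalPolarization Φ₁ (pullbackForm F (prodForm η ω)) :=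
  (hP.prod hJ).pullbackForm_of_abs_polarizationDegree (prodPeriod Φ Φ₂) Φ₁ hF hdeg

/-- **Into an IRREDUCIBLE principally polarized abelian variety (Def. 3.22)**: the source of a morphism
`φ : 𝒯' → (X, Θ)` of principally polarized complex tori is `0`, or a principally polarized abelian variety isomorphic
to `(X, Θ)` via `φ`. [cite: ClemensGriffiths1972, §3 (3.18) and Def. 3.22, pp. 296–297] -/
theorem IsPrincipalPolarization.isEmpty_or_isPrincipalPolarization_and_exists_isPolarizedIso
    (hP : IsPrincipalPolarization Φ η) (hirr : IsPolarizedIrreducible Φ η)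
    {ι₁ : Type} [Fintype ι₁] [DecidableEq ι₁] {E₁ : Type u} [NormedAddCommGroup E₁] [NormedSpace ℂ E₁]
    (Φ₁ : (ι₁ → ℝ) ≃L[ℝ] E₁) {M : Matrix ι ι₁ ℤ} {F : E₁ →L[ℂ] E}
    (hF : ∀ x, Φ ((M.map (Int.cast : ℤ → ℝ)) *ᵥ x) = F (Φ₁ x)) (hdeg : |polarizationDegree Φ₁ (pullbackForm F η)| = 1) :
    IsEmpty ι₁ ∨ (IsPrincipalPolarization Φ₁ (pullbackForm F η) ∧ ∃ h : ComplexTorus Φ₁ ≃+ ComplexTorus Φ,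
      IsPolarizedIso Φ₁ (pullbackForm F η) Φ η h ∧ ⇑h = mapMatrix Φ₁ Φ M) := by
  rcases hirr Φ₁ M F hF hdeg with h | h
  · exact Or.inl h
  · exact Or.inr ⟨hP.pullbackForm_of_abs_polarizationDegree Φ Φ₁ hF hdeg, h⟩

end PositivityTransfer

end ComplexTorus

end Literature.Geometry.Kaehler

end
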